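import Literature.Analysis.Matrix.SchoenbergKernelsProofs
import Mathlib.Analysis.Fourier.FiniteAbelian.PontryaginDuality
import HarnessLib

/-!
# Crux `Block2InfDivXXZ` (stmt-HubbardSuperconductivity-15048, route `LevyLogBootstrap`):
# finite Bochner toolkit — negative type of a translation-invariant kernel on a finite abelian
# group ⇔ sign conditions on its Fourier (Lévy) coefficients

Helper file (`--supports stmt-HubbardSuperconductivity-15048`). The registered load-bearing stub
`stub_blockLogNegType` of line `birth` asks that `(x, y) ↦ -log K₂(x, y)` be a negative definite
kernel (`Literature.Analysis.Matrix.IsNegDefKernel`, BCR Def. 3.1.1). The block kernel `K₂` is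
(block-)translation invariant on the coarse torus `(ℤ/(M/2))²` (sibling file), so the stub is a
statement about a kernel `(X, Y) ↦ φ(X - Y)` on a FINITE ABELIAN GROUP. This file proves the
elementary harmonic analysis that turns such a statement into finitely many sign conditions
("Lévy coefficients `ν_χ ≥ 0`", the quantities the route's `LevyTransport` consumes and the
numerics measure):

* `isPosDefKernel_iff_fintype`, `isNegDefKernel_iff_fintype` — on a finite type the BCR
  definitions (arbitrary finite families, repetitions allowed) are equivalent to the single
  quadratic-form condition over the whole type (aggregation along fibres);
* `isPosDefKernel_comp_iff`, `isNegDefKernel_comp_iff` — pulling a kernel back along a surjection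
  preserves and reflects (negative/positive) definiteness;
* `sum_addChar_fourier_quadratic` — Plancherel for the quadratic form of a translation-invariant
  kernel: `|G| Σ_{a,b} C(a) C(b) f(a-b) = Σ_χ f̂(χ) |Ĉ(χ)|²` over the complex characters
  `χ : AddChar G ℂ` (Mathlib `AddChar.sum_apply_eq_ite`);
* `isNegDefKernel_sub_iff_addChar` — **finite Bochner / Lévy–Khintchine on a finite abelian
  group**: `(x, y) ↦ f(x - y)` is negative definite iff `f` is even and `Re f̂(χ) ≤ 0` for every
  non-trivial character; `isNegDefKernel_neg_sub_iff_addChar` — the `-log` form used by the crux: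
  `(x, y) ↦ -f(x - y)` is negative definite iff `f` is even and `0 ≤ Re Σ_u f(u) χ(u)` for all
  `χ ≠ 0`.

Sources: C. Berg, J. P. R. Christensen, P. Ressel, *Harmonic Analysis on Semigroups* (1984),
Ch. 3 §1 (definitions), Ch. 4 §3 (Lévy–Khintchine on abelian groups; for a finite group the Lévy
measure is the finite family `ν_χ = -f̂(χ)/|G|`, `χ ≠ 0`); W. Rudin, *Fourier Analysis on Groups*
§1.4 (Bochner). All statements here are finite-dimensional and proved from Mathlib's character
orthogonality; no definition is introduced.
-/

noncomputable section

set_option linter.dupNamespace false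

namespace Summit.HubbardSuperconductivity.HubbardSuperconductivity.Theorems.LevyLogBootstrap

open scoped BigOperators ComplexConjugate
open Finset Literature.Analysis.Matrix

/-! ### Aggregation along fibres: the BCR definitions on a finite type -/

section FintypeForms

variable {X : Type*} [Fintype X] [DecidableEq X]

/-- Aggregating a weighted sum over a finite family `x : Fin n → X` along its fibres:
`Σ_j c_j F(x_j) = Σ_a (Σ_{j : x_j = a} c_j) F(a)`. [folklore] -/
theorem sum_mul_apply_eq_sum_fiber {n : ℕ} (x : Fin n → X) (c : Fin n → ℝ) (F : X → ℝ) :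
    ∑ j, c j * F (x j) = ∑ a, (∑ j, if x j = a then c j else 0) * F a := by
  simp_rw [Finset.sum_mul]
  rw [Finset.sum_comm]
  refine Finset.sum_congr rfl fun j _ => ?_
  simp_rw [ite_mul, zero_mul]
  rw [Finset.sum_ite_eq]
  simp

/-- The quadratic form of a kernel over a finite family equals the quadratic form over the type
with the aggregated coefficients `C(a) = Σ_{j : x_j = a} c_j`. [folklore] -/
theorem sum_sum_mul_mul_eq_sum_fiber {n : ℕ} (x : Fin n → X) (c : Fin n → ℝ) (k : X → X → ℝ) :
    ∑ j, ∑ l, c j * c l * k (x j) (x l) =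
      ∑ a, ∑ b, (∑ j, if x j = a then c j else 0) * (∑ l, if x l = b then c l else 0) * k a b := by
  have inner : ∀ j, ∑ l, c j * c l * k (x j) (x l) =
      c j * ∑ b, (∑ l, if x l = b then c l else 0) * k (x j) b := by
    intro j
    rw [← sum_mul_apply_eq_sum_fiber x c (k (x j)), Finset.mul_sum]
    exact Finset.sum_congr rfl fun l _ => by ring
  simp_rw [inner]
  rw [sum_mul_apply_eq_sum_fiber x c (fun a => ∑ b, (∑ l, if x l = b then c l else 0) * k a b)]
  refine Finset.sum_congr rfl fun a _ => ?_
  rw [Finset.mul_sum]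
  exact Finset.sum_congr rfl fun b _ => by ring

/-- The aggregated coefficients have the same total: `Σ_a Σ_{j : x_j = a} c_j = Σ_j c_j`. [folklore] -/
theorem sum_fiber_eq_sum {n : ℕ} (x : Fin n → X) (c : Fin n → ℝ) :
    ∑ a, (∑ j, if x j = a then c j else 0) = ∑ j, c j := by
  have h := sum_mul_apply_eq_sum_fiber x c (fun _ => 1)
  simp only [mul_one] at h
  exact h.symm

/-- **Positive definiteness on a finite type** (BCR Def. 3.1.1 with repetitions allowed ⇔ one
quadratic-form condition over the whole type): a kernel `k` on a finite type is positive definite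
iff it is symmetric and `Σ_{a,b} c(a) c(b) k(a,b) ≥ 0` for every `c : X → ℝ`.
[cite: BergChristensenRessel1984, Ch. 3 §1.1–1.2] -/
theorem isPosDefKernel_iff_fintype (k : X → X → ℝ) :
    IsPosDefKernel k ↔ (∀ x y, k x y = k y x) ∧ ∀ c : X → ℝ, 0 ≤ ∑ a, ∑ b, c a * c b * k a b := by
  constructor
  · rintro ⟨hs, hp⟩
    refine ⟨hs, fun c => ?_⟩
    set e := (Fintype.equivFin X).symm with he
    have h := hp (Fintype.card X) (fun j => e j) (fun j => c (e j))
    have hsum : ∑ j, ∑ l, c (e j) * c (e l) * k (e j) (e l) = ∑ a, ∑ b, c a * c b * k a b := by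
      rw [Equiv.sum_comp e (fun a => ∑ l, c a * c (e l) * k a (e l))]
      exact Finset.sum_congr rfl fun a _ => Equiv.sum_comp e (fun b => c a * c b * k a b)
    rwa [hsum] at h
  · rintro ⟨hs, hp⟩
    refine ⟨hs, fun n x c => ?_⟩
    rw [sum_sum_mul_mul_eq_sum_fiber]
    exact hp _

/-- **Negative definiteness on a finite type**: a kernel `k` on a finite type is negative
definite iff it is symmetric and `Σ_{a,b} c(a) c(b) k(a,b) ≤ 0` for every `c : X → ℝ` with
`Σ_a c(a) = 0`. [cite: BergChristensenRessel1984, Ch. 3 §1.1–1.2] -/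
theorem isNegDefKernel_iff_fintype (k : X → X → ℝ) :
    IsNegDefKernel k ↔
      (∀ x y, k x y = k y x) ∧ ∀ c : X → ℝ, ∑ a, c a = 0 → ∑ a, ∑ b, c a * c b * k a b ≤ 0 := by
  constructor
  · rintro ⟨hs, hp⟩
    refine ⟨hs, fun c hc => ?_⟩
    set e := (Fintype.equivFin X).symm with he
    have hc' : ∑ j, c (e j) = 0 := by rw [Equiv.sum_comp e (fun a => c a), hc]
    have h := hp (Fintype.card X) (fun j => e j) (fun j => c (e j)) hc'
    have hsum : ∑ j, ∑ l, c (e j) * c (e l) * k (e j) (e l) = ∑ a, ∑ b, c a * c b * k a b := by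
      rw [Equiv.sum_comp e (fun a => ∑ l, c a * c (e l) * k a (e l))]
      exact Finset.sum_congr rfl fun a _ => Equiv.sum_comp e (fun b => c a * c b * k a b)
    rwa [hsum] at h
  · rintro ⟨hs, hp⟩
    refine ⟨hs, fun n x c hc => ?_⟩
    rw [sum_sum_mul_mul_eq_sum_fiber]
    refine hp _ ?_
    rw [sum_fiber_eq_sum, hc]

end FintypeForms

/-! ### Pull-back of kernels along a surjection -/

section Pullback

variable {X Y : Type*}

/-- Pulling back a kernel along a SURJECTION preserves and reflects positive definiteness:
`(x, x') ↦ k(b x, b x')` is positive definite iff `k` is. (Only `⇒` needs surjectivity.)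
[cite: BergChristensenRessel1984, Ch. 3 §1.9] -/
theorem isPosDefKernel_comp_iff (k : Y → Y → ℝ) {b : X → Y} (hb : Function.Surjective b) :
    IsPosDefKernel (fun x x' => k (b x) (b x')) ↔ IsPosDefKernel k := by
  constructor
  · rintro ⟨hs, hp⟩
    refine ⟨fun y y' => ?_, fun n y c => ?_⟩
    · obtain ⟨x, rfl⟩ := hb y
      obtain ⟨x', rfl⟩ := hb y'
      exact hs x x'
    · have h := hp n (fun j => Function.surjInv hb (y j)) c
      simp only [Function.surjInv_eq hb] at h
      exact h
  · rintro ⟨hs, hp⟩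
    exact ⟨fun x x' => hs (b x) (b x'), fun n x c => hp n (fun j => b (x j)) c⟩

/-- Pulling back a kernel along a SURJECTION preserves and reflects negative definiteness:
`(x, x') ↦ k(b x, b x')` is negative definite iff `k` is. (Only `⇒` needs surjectivity.)
[cite: BergChristensenRessel1984, Ch. 3 §1.9] -/
theorem isNegDefKernel_comp_iff (k : Y → Y → ℝ) {b : X → Y} (hb : Function.Surjective b) :
    IsNegDefKernel (fun x x' => k (b x) (b x')) ↔ IsNegDefKernel k := by
  constructor
  · rintro ⟨hs, hp⟩
    refine ⟨fun y y' => ?_, fun n y c hc => ?_⟩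
    · obtain ⟨x, rfl⟩ := hb y
      obtain ⟨x', rfl⟩ := hb y'
      exact hs x x'
    · have h := hp n (fun j => Function.surjInv hb (y j)) c hc
      simp only [Function.surjInv_eq hb] at h
      exact h
  · rintro ⟨hs, hp⟩
    exact ⟨fun x x' => hs (b x) (b x'), fun n x c hc => hp n (fun j => b (x j)) c hc⟩

end Pullback

/-! ### Harmonic analysis on a finite abelian group -/

section FiniteBochner

variable {G : Type*} [AddCommGroup G] [Fintype G] [DecidableEq G]

/-- Character orthogonality in the form used below: `Σ_χ χ(u) χ(-a) χ(b) = |G|·[u - a + b = 0]`.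
(Mathlib `AddChar.sum_apply_eq_ite`). [folklore] -/
theorem sum_addChar_mul_mul (u a b : G) :
    ∑ χ : AddChar G ℂ, χ u * conj (χ a) * χ b =
      if u - a + b = 0 then (Fintype.card G : ℂ) else 0 := by
  rw [← AddChar.sum_apply_eq_ite (u - a + b)]
  refine Finset.sum_congr rfl fun χ _ => ?_
  rw [← AddChar.map_neg_eq_conj, ← AddChar.map_add_eq_mul, ← AddChar.map_add_eq_mul,
    sub_eq_add_neg]

/-- **Plancherel for the quadratic form of a translation-invariant kernel.** For `f : G → ℝ` and
real coefficients `C`,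
`Σ_χ f̂(χ) · (Σ_a C(a) conj χ(a)) · (Σ_b C(b) χ(b)) = |G| · Σ_{a,b} C(a) C(b) f(a - b)`,
`f̂(χ) = Σ_u f(u) χ(u)`, summed over the complex characters of the finite abelian group `G`.
(Rudin, *Fourier Analysis on Groups* §1.4.) [cite: BergChristensenRessel1984, Ch. 4 §3] -/
theorem sum_addChar_fourier_quadratic (f : G → ℝ) (C : G → ℝ) :
    ∑ χ : AddChar G ℂ, (∑ u, (f u : ℂ) * χ u) *
        ((∑ a, (C a : ℂ) * conj (χ a)) * (∑ b, (C b : ℂ) * χ b)) =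
      (Fintype.card G : ℂ) * ∑ a, ∑ b, ((C a * C b * f (a - b) : ℝ) : ℂ) := by
  -- expand the products of sums
  have hexp : ∀ χ : AddChar G ℂ, (∑ u, (f u : ℂ) * χ u) *
      ((∑ a, (C a : ℂ) * conj (χ a)) * (∑ b, (C b : ℂ) * χ b)) =
      ∑ u, ∑ a, ∑ b, (f u : ℂ) * (C a : ℂ) * (C b : ℂ) * (χ u * conj (χ a) * χ b) := by
    intro χ
    rw [Finset.sum_mul_sum, Finset.sum_mul]
    refine Finset.sum_congr rfl fun u _ => ?_
    rw [Finset.mul_sum]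
    refine Finset.sum_congr rfl fun a _ => ?_
    rw [Finset.mul_sum]
    exact Finset.sum_congr rfl fun b _ => by ring
  simp_rw [hexp]
  -- move the character sum inside
  rw [Finset.sum_comm]
  simp_rw [Finset.sum_comm (s := (Finset.univ : Finset (AddChar G ℂ)))]
  -- note: after the rewrites the χ-sum is innermost
  have hin : ∀ u a b : G, ∑ χ : AddChar G ℂ, (f u : ℂ) * (C a : ℂ) * (C b : ℂ) * (χ u * conj (χ a) * χ b)
      = (f u : ℂ) * (C a : ℂ) * (C b : ℂ) * (if u - a + b = 0 then (Fintype.card G : ℂ) else 0) := by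
    intro u a b
    rw [← Finset.mul_sum, sum_addChar_mul_mul]
  simp_rw [hin]
  -- evaluate the `u`-sum on the constraint `u = a - b`
  rw [Finset.mul_sum, Finset.sum_comm]
  refine Finset.sum_congr rfl fun a _ => ?_
  rw [Finset.mul_sum, Finset.sum_comm]
  refine Finset.sum_congr rfl fun b _ => ?_
  have hcond : ∀ u : G, (u - a + b = 0) ↔ (a - b = u) := by
    intro u
    constructor
    · intro h
      rw [sub_add, sub_eq_zero] at h
      exact h.symm
    · rintro rfl
      abel
  simp_rw [hcond]
  simp_rw [mul_ite, mul_zero]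
  rw [Finset.sum_ite_eq]
  simp only [Finset.mem_univ, if_true]
  push_cast
  ring

omit [Fintype G] [DecidableEq G] in
/-- The kernel `(x, y) ↦ f(x - y)` is symmetric iff `f` is even. [folklore] -/
theorem symmetric_sub_iff_even (f : G → ℝ) :
    (∀ x y : G, f (x - y) = f (y - x)) ↔ ∀ x, f (-x) = f x := by
  constructor
  · intro h x
    have := h 0 x
    rwa [zero_sub, sub_zero] at this
  · intro h x y
    rw [← neg_sub y x, h]

/-- **Finite Bochner theorem for kernels of negative type (Lévy–Khintchine on a finite abelian
group).** For a real function `f` on a finite abelian group `G`, the translation-invariant kernel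
`(x, y) ↦ f(x - y)` is negative definite (BCR Def. 3.1.1) iff `f` is even and every non-trivial
Fourier coefficient has non-positive real part: `Re Σ_u f(u) χ(u) ≤ 0` for all complex characters
`χ ≠ 0` (the trivial character is unconstrained — the zero mode is killed by `Σ c = 0`).
Proof: Plancherel for the quadratic form (`sum_addChar_fourier_quadratic`) for `⇐`; the test
vectors `Re χ`, `Im χ` (which sum to zero for `χ ≠ 0`) for `⇒`.
[cite: BergChristensenRessel1984, Ch. 4 §3 (Lévy–Khintchine on abelian groups), Ch. 3 Def. 1.1] -/
theorem isNegDefKernel_sub_iff_addChar (f : G → ℝ) :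
    IsNegDefKernel (fun x y : G => f (x - y)) ↔
      (∀ x, f (-x) = f x) ∧
        ∀ χ : AddChar G ℂ, χ ≠ 0 → (∑ u, (f u : ℂ) * χ u).re ≤ 0 := by
  rw [isNegDefKernel_iff_fintype, symmetric_sub_iff_even]
  have hcard : (0 : ℝ) < Fintype.card G := Nat.cast_pos.2 Fintype.card_pos
  constructor
  · rintro ⟨heven, hq⟩
    refine ⟨heven, fun χ hχ => ?_⟩
    have hsum0 : ∑ a, χ a = 0 := AddChar.sum_eq_zero_iff_ne_zero.2 hχ
    have hre : ∑ a, (χ a).re = 0 := by rw [← Complex.re_sum, hsum0, Complex.zero_re]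
    have him : ∑ a, (χ a).im = 0 := by rw [← Complex.im_sum, hsum0, Complex.zero_im]
    have h1 := hq (fun a => (χ a).re) hre
    have h2 := hq (fun a => (χ a).im) him
    -- the two quadratic forms add up to `|G| · Re f̂(χ)`
    have hab : ∀ a b : G, (χ a).re * (χ b).re * f (a - b) + (χ a).im * (χ b).im * f (a - b)
        = (χ (a - b)).re * f (a - b) := by
      intro a b
      rw [AddChar.map_sub_eq_div, div_eq_mul_inv, AddChar.inv_apply_eq_conj, Complex.mul_re,
        Complex.conj_re, Complex.conj_im]
      ring
    have hrow : ∀ b : G, ∑ a, ((χ a).re * (χ b).re * f (a - b) + (χ a).im * (χ b).im * f (a - b))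
        = ∑ u, (χ u).re * f u := by
      intro b
      simp_rw [hab]
      exact Fintype.sum_equiv (Equiv.subRight b) _ _ (fun a => rfl)
    have hadd : ∑ a, ∑ b, (χ a).re * (χ b).re * f (a - b) +
        ∑ a, ∑ b, (χ a).im * (χ b).im * f (a - b) =
        (Fintype.card G : ℝ) * (∑ u, (f u : ℂ) * χ u).re := by
      rw [← Finset.sum_add_distrib]
      simp_rw [← Finset.sum_add_distrib]
      rw [Finset.sum_comm]
      simp_rw [hrow]
      rw [Finset.sum_const, Finset.card_univ, nsmul_eq_mul, Complex.re_sum]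
      congr 1
      refine Finset.sum_congr rfl fun u _ => ?_
      rw [Complex.re_ofReal_mul]
      ring
    have hle : (Fintype.card G : ℝ) * (∑ u, (f u : ℂ) * χ u).re ≤ 0 := by
      rw [← hadd]; linarith
    exact le_of_mul_le_mul_left (by rwa [mul_zero]) hcard
  · rintro ⟨heven, hχ⟩
    refine ⟨heven, fun c hc => ?_⟩
    -- Plancherel: `|G| Q = Σ_χ Re f̂(χ) |ĉ(χ)|²`
    have hP := sum_addChar_fourier_quadratic f c
    have hconj : ∀ χ : AddChar G ℂ,
        (∑ a, (c a : ℂ) * conj (χ a)) = conj (∑ b, (c b : ℂ) * χ b) := by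
      intro χ
      rw [map_sum]
      refine Finset.sum_congr rfl fun a _ => ?_
      rw [map_mul, Complex.conj_ofReal]
    simp_rw [hconj, ← Complex.normSq_eq_conj_mul_self] at hP
    have hR : ((Fintype.card G : ℂ) * ∑ a, ∑ b, ((c a * c b * f (a - b) : ℝ) : ℂ)).re =
        (Fintype.card G : ℝ) * ∑ a, ∑ b, c a * c b * f (a - b) := by
      rw [← Complex.ofReal_natCast]
      simp_rw [← Complex.ofReal_sum]
      rw [← Complex.ofReal_mul, Complex.ofReal_re]
    have hL : (∑ χ : AddChar G ℂ, (∑ u, (f u : ℂ) * χ u) *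
        (Complex.normSq (∑ b, (c b : ℂ) * χ b) : ℂ)).re ≤ 0 := by
      rw [Complex.re_sum]
      refine Finset.sum_nonpos fun χ _ => ?_
      rw [Complex.re_mul_ofReal]
      by_cases h0 : χ = 0
      · subst h0
        have : ∑ b, (c b : ℂ) * (0 : AddChar G ℂ) b = 0 := by
          simp_rw [AddChar.zero_apply, mul_one]
          rw [← Complex.ofReal_sum, hc, Complex.ofReal_zero]
        rw [this, map_zero, mul_zero]
      · exact mul_nonpos_of_nonpos_of_nonneg (hχ χ h0) (Complex.normSq_nonneg _)
    rw [hP, hR] at hL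
    exact le_of_mul_le_mul_left (by rwa [mul_zero]) hcard

/-- **The `-log` form used by the crux.** For a real function `f` on a finite abelian group, the
kernel `(x, y) ↦ -f(x - y)` is negative definite iff `f` is even and `0 ≤ Re Σ_u f(u) χ(u)` for
every non-trivial complex character `χ` — with `f = log κ` these are the LÉVY COEFFICIENTS
`ν_χ ∝ Σ_Z log κ(Z) χ(Z) ≥ 0`, `χ ≠ 0`, of the route's thesis. [cite: BergChristensenRessel1984, Ch. 4 §3] -/
theorem isNegDefKernel_neg_sub_iff_addChar (f : G → ℝ) :
    IsNegDefKernel (fun x y : G => -f (x - y)) ↔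
      (∀ x, f (-x) = f x) ∧
        ∀ χ : AddChar G ℂ, χ ≠ 0 → 0 ≤ (∑ u, (f u : ℂ) * χ u).re := by
  have h := isNegDefKernel_sub_iff_addChar (fun u => -f u)
  rw [h]
  refine and_congr ⟨fun he x => ?_, fun he x => ?_⟩ (forall_congr' fun χ => imp_congr_right fun _ => ?_)
  · have := he x; linarith
  · rw [he x]
  · have hs : (∑ u, ((-f u : ℝ) : ℂ) * χ u).re = -(∑ u, (f u : ℂ) * χ u).re := by
      rw [← Complex.neg_re, ← Finset.sum_neg_distrib]
      congr 1
      refine Finset.sum_congr rfl fun u _ => ?_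
      push_cast
      ring
    rw [hs]
    constructor <;> intro hh <;> linarith

/-- **Registered form (`--supports stmt-HubbardSuperconductivity-15048`, sub-goal
`finiteBochner_negLogType_iff`)** of `isNegDefKernel_neg_sub_iff_addChar`, fully explicit: for a
finite abelian group `G` and `f : G → ℝ`, `(x, y) ↦ -f(x - y)` is negative definite iff `f` is
even and `0 ≤ Re Σ_u f(u) χ(u)` for every non-trivial complex character `χ`.
[cite: BergChristensenRessel1984, Ch. 4 §3] -/
theorem finiteBochner_negLogType_iff :
    ∀ (G : Type) [AddCommGroup G] [Fintype G] [DecidableEq G] (f : G → ℝ),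
      IsNegDefKernel (fun x y : G => -f (x - y)) ↔
        ((∀ x : G, f (-x) = f x) ∧
          ∀ χ : AddChar G ℂ, χ ≠ 0 → 0 ≤ (∑ u : G, (f u : ℂ) * χ u).re) :=
  fun _ _ _ _ f => isNegDefKernel_neg_sub_iff_addChar f

end FiniteBochner

end Summit.HubbardSuperconductivity.HubbardSuperconductivity.Theorems.LevyLogBootstrap

end
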